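import Summits.AtomisticToContinuum.Crystallization.Theorems.FreeSplittingCertificatesStrictSplittingRuleTorusModel442LS
import Mathlib.Logic.Equiv.Fin.Basic

/-!
# The joint (r6) sitewise LMI on an hcp torus `N₁ × N₁ × 2N₃` of ANY size — the model in Lean, generic in the torus shape

Route `FreeSplittingCertificates`, crux `StrictSplittingRule` (stmt-AtomisticToContinuum-12560); unit b2b-freesplit-B (block 2b,
PART B, gen 1).  VALUE = certificate infrastructure for FINITE models — NOT summit progress; `stub_coreJointCoercive` is not proved.

`…TorusModel442Defs.lean` writes the finite model for the 4×4×2 torus with the size hard-wired (`Site = Fin 4 × Fin 4 × Fin 4`,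
192 coordinates).  This file repeats the SIZE-DEPENDENT half of that model generically in the torus shape `(NK, N1)` = (number of
layers `2N₃`, in-layer period `N₁`): sites `SiteG NK N1 = Fin NK × Fin N1 × Fin N1`, `dimG NK N1 = NK·N1·N1·3` coordinates
(`idxG` via `finProdFinEquiv`, value `3(N1²k + N1 i + j) + c`), torus addition, the functionals (relative displacements, least-squares
co-rotation `thetaG`/`WyG`/`residG`, elongations `dlG`), and the term lists `supplyTermsG`, `kappaTermsG`, `readoutTermsG`,
`transferTermsG`, `normTermsG`, `projTermsG`, `certTermsG` — VERBATIM the 4×4×2 definitions with `4 ↦ NK, N1` (the size-independent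
objects `V`, `ipG`, `offsets`, `ljW1/ljW2`, `Cmat/Jmat/inv3`, `betaLookup`, `tableX`, … are imported from the 4×4×2 file; the β data
`betaTable` is size-independent — it depends only on `(a₀, h₀)` and the cut-off).  Instantiated for 5×5×2 in `…TorusModel552.lean`.
[folklore]
-/

namespace Summit.AtomisticToContinuum.Crystallization.Theorems.StrictSplittingRuleTorusLMI

open Literature.Computation.Certificates

section Shape

variable (NK N1 : ℕ) [NeZero NK] [NeZero N1]

/-- Sites of the torus `ℤ_NK × ℤ_N1 × ℤ_N1` (`k` = layer, `NK = 2N₃`). [folklore] -/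
abbrev SiteG := Fin NK × Fin N1 × Fin N1

/-- Number of displacement coordinates `3·|T|`. [folklore] -/
abbrev dimG : ℕ := NK * N1 * N1 * 3

/-- Parity of a site: `true` = A layer (`k` even). [folklore] -/
def parityG (p : SiteG NK N1) : Bool := p.1.val % 2 == 0

/-- Reduction of an integer mod `N` (as `Fin N`). [folklore] -/
def zmodG (N : ℕ) [NeZero N] (z : ℤ) : Fin N := Fin.ofNat N (z % N).toNat

/-- Torus addition `p + d`. [folklore] -/
def taddG (p : SiteG NK N1) (d : Off) : SiteG NK N1 :=
  (zmodG NK (p.1.val + d.1), zmodG N1 (p.2.1.val + d.2.1), zmodG N1 (p.2.2.val + d.2.2))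

/-- Coordinate index `idxG (k,i,j) c = 3(N1² k + N1 i + j) + c` (row-major, via `finProdFinEquiv`). [folklore] -/
def idxG (q : SiteG NK N1) (c : Fin 3) : Fin (dimG NK N1) :=
  finProdFinEquiv (finProdFinEquiv (finProdFinEquiv (q.1, q.2.1), q.2.2), c)

/-- All sites, `k`-major. [folklore] -/
def allSitesG : List (SiteG NK N1) :=
  (List.finRange NK).flatMap fun k => (List.finRange N1).flatMap fun i => (List.finRange N1).map fun j => (k, i, j)

/-! ### Functionals -/

/-- `u_{q,c} − u_{p,c}`. [folklore] -/
def eRelG (p q : SiteG NK N1) (c : Fin 3) : LinF (dimG NK N1) := [(idxG NK N1 q c, 1), (idxG NK N1 p c, -1)]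

/-- `⟨y, F(u)⟩_G` for a vector-valued functional. [folklore] -/
def dotGN {n : ℕ} (y : Fin 3 → ℚ) (F : Fin 3 → LinF n) : LinF n :=
  (LinF.smul (gW 0 * y 0) (F 0)).add ((LinF.smul (gW 1 * y 1) (F 1)).add (LinF.smul (gW 2 * y 2) (F 2)))

/-- Insert-and-merge (generic dimension). [folklore] -/
def insertAddN {n : ℕ} (p : Fin n × ℚ) : LinF n → LinF n
  | [] => [p]
  | q :: t => if q.1 = p.1 then (q.1, q.2 + p.2) :: t else q :: insertAddN p t

/-- `insertAddN` adds `p.2 · u p.1`. [folklore] -/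
theorem eval_insertAddN {n : ℕ} (p : Fin n × ℚ) (ℓ : LinF n) (u : Fin n → ℚ) :
    LinF.eval (insertAddN p ℓ) u = p.2 * u p.1 + LinF.eval ℓ u := by
  induction ℓ with
  | nil => simp [insertAddN]
  | cons q t ih =>
    by_cases h : q.1 = p.1
    · simp only [insertAddN, h, if_true, LinF.eval_cons]; ring
    · simp only [insertAddN, h, if_false, LinF.eval_cons, ih]; ring

/-- Merge repeated coordinates (generic dimension). [folklore] -/
def compressN {n : ℕ} (ℓ : LinF n) : LinF n := ℓ.foldr insertAddN []

/-- `compressN` does not change the functional. [folklore] -/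
theorem eval_compressN {n : ℕ} (ℓ : LinF n) (u : Fin n → ℚ) : LinF.eval (compressN ℓ) u = LinF.eval ℓ u := by
  induction ℓ with
  | nil => simp [compressN]
  | cons q t ih =>
    simp only [compressN, List.foldr_cons] at ih ⊢
    rw [eval_insertAddN, ih, LinF.eval_cons]

/-- Least-squares rotation parameters `θ_k(u)` of site `p` (normal equations, exact inverse). [folklore] -/
def thetaG (p : SiteG NK N1) (k : Fin 3) : LinF (dimG NK N1) :=
  let b := parityG NK N1 p
  let Ji := inv3 (Jmat b)
  compressN <| (shell b).flatMap fun s => [(0 : Fin 3), 1, 2].flatMap fun r =>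
    LinF.smul (Ji k 0 * Cmat (V b s) r 0 + Ji k 1 * Cmat (V b s) r 1 + Ji k 2 * Cmat (V b s) r 2)
      (eRelG NK N1 p (taddG NK N1 p s) r)

/-- `[θ₀, θ₁, θ₂]` of `p`. [folklore] -/
def thetaListG (p : SiteG NK N1) : List (LinF (dimG NK N1)) := [thetaG NK N1 p 0, thetaG NK N1 p 1, thetaG NK N1 p 2]

/-- `(W(u) y)_r = (1/g_r) Σ_k C_y[r][k] θ_k(u)`. [folklore] -/
def WyG {n : ℕ} (ths : List (LinF n)) (y : Fin 3 → ℚ) (r : Fin 3) : LinF n :=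
  compressN <| LinF.smul (Cmat y r 0 / gW r) (ths.getD 0 []) ++ LinF.smul (Cmat y r 1 / gW r) (ths.getD 1 []) ++
    LinF.smul (Cmat y r 2 / gW r) (ths.getD 2 [])

/-- Co-rotated residual `(u_q − u_m − W(u) y)_c`. [folklore] -/
def residG (ths : List (LinF (dimG NK N1))) (m q : SiteG NK N1) (y : Fin 3 → ℚ) (c : Fin 3) : LinF (dimG NK N1) :=
  (eRelG NK N1 m q c).sub (WyG ths y c)

/-- First-shell elongations `dl(m)`. [folklore] -/
def dlG (m : SiteG NK N1) : List (LinF (dimG NK N1)) :=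
  (shell (parityG NK N1 m)).map fun s => dotGN (V (parityG NK N1 m) s) (fun c => eRelG NK N1 m (taddG NK N1 m s) c)

/-- Weighted square term. [folklore] -/
def sqN {n : ℕ} (c : ℚ) (ℓ : LinF n) : Term n := (c, ℓ, ℓ)

/-! ### Term lists (verbatim the 4×4×2 ones) -/

/-- SUPPLY terms at `p`. [folklore] -/
def supplyTermsG (p : SiteG NK N1) (ths : List (LinF (dimG NK N1))) : List (Term (dimG NK N1)) :=
  let b := parityG NK N1 p
  (offsets b Rc2).flatMap fun d =>
    let y := V b d
    let s := ipG y y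
    let q := taddG NK N1 p d
    [sqN (rnd 60 (ljW1 s) / 2 * gW 0) (residG NK N1 ths p q y 0), sqN (rnd 60 (ljW1 s) / 2 * gW 1) (residG NK N1 ths p q y 1),
      sqN (rnd 60 (ljW1 s) / 2 * gW 2) (residG NK N1 ths p q y 2), sqN (rnd 60 (ljW2 s)) (dotGN y fun c => eRelG NK N1 p q c)]

/-- κ-DEMAND terms at `p`. [folklore] -/
def kappaTermsG (p : SiteG NK N1) (ths : List (LinF (dimG NK N1))) : List (Term (dimG NK N1)) :=
  let b := parityG NK N1 p
  (shell b).flatMap fun s =>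
    let y := V b s
    let q := taddG NK N1 p s
    [sqN kappa1 (dotGN y fun c => eRelG NK N1 p q c), sqN (kappa3 * gW 0) (residG NK N1 ths p q y 0),
      sqN (kappa3 * gW 1) (residG NK N1 ths p q y 1), sqN (kappa3 * gW 2) (residG NK N1 ths p q y 2)]

/-- READOUT-FORM terms at `p`. [folklore] -/
def readoutTermsG (p : SiteG NK N1) (ths : List (LinF (dimG NK N1))) (btab : List ((Bool × Off × Off) × ℚ)) :
    List (Term (dimG NK N1)) :=
  let b := parityG NK N1 p
  (((0, 0, 0) : Off) :: offsets b Rc2).flatMap fun d =>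
    let bq := if d.1 % 2 = 0 then b else !b
    let q := taddG NK N1 p d
    let yq := V b d
    Y1.flatMap fun s =>
      let bv := betaLookup btab bq (negOff d) s
      let ys := V true s
      if bv = 0 then [] else
        if ipG (fun c => yq c + ys c) (fun c => yq c + ys c) ≤ Rc2 then
          [sqN (bv / 2 * gW 0) (residG NK N1 ths q (taddG NK N1 q s) ys 0),
            sqN (bv / 2 * gW 1) (residG NK N1 ths q (taddG NK N1 q s) ys 1),
            sqN (bv / 2 * gW 2) (residG NK N1 ths q (taddG NK N1 q s) ys 2)]
        else []

/-- TRANSFER terms at `p` for the table classes `tcls`. [folklore] -/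
def transferTermsG (p : SiteG NK N1) (tcls : List (Bool × Off × Bool × Bool × List ℤ)) : List (Term (dimG NK N1)) :=
  let b := parityG NK N1 p
  tcls.flatMap fun cl =>
    let X := tableX cl.2.2.2.1 cl.2.2.2.2
    let pl1 : List (ℚ × List (LinF (dimG NK N1))) :=
      if cl.1 == b then [(1, dlG NK N1 p ++ dlG NK N1 (taddG NK N1 p cl.2.1))] else []
    let pl2 : List (ℚ × List (LinF (dimG NK N1))) :=
      if cl.2.2.1 == b then [(-1, dlG NK N1 (taddG NK N1 p (negOff cl.2.1)) ++ dlG NK N1 p)] else []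
    (pl1 ++ pl2).flatMap fun pz =>
      X.map fun e => (pz.1 * e.2.2 * (if e.1 = e.2.1 then 1 else 2), pz.2.getD e.1 [], pz.2.getD e.2.1 [])

/-- NORM terms `g_c u_{q,c}²`. [folklore] -/
def normTermsG : List (Term (dimG NK N1)) :=
  (allSitesG NK N1).flatMap fun q =>
    [sqN (gW 0) (LinF.coord (idxG NK N1 q 0)), sqN (gW 1) (LinF.coord (idxG NK N1 q 1)), sqN (gW 2) (LinF.coord (idxG NK N1 q 2))]

/-- Component-sum functional `Σ_q u_{q,c}`. [folklore] -/
def sumFG (c : Fin 3) : LinF (dimG NK N1) := (allSitesG NK N1).map fun q => (idxG NK N1 q c, 1)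

/-- Translation projector terms `(g_c/|T|)·(Σ_q u_{q,c})²`. [folklore] -/
def projTermsG : List (Term (dimG NK N1)) :=
  let nT : ℚ := (NK * N1 * N1 : ℕ)
  [sqN (gW 0 / nT) (sumFG NK N1 0), sqN (gW 1 / nT) (sumFG NK N1 1), sqN (gW 2 / nT) (sumFG NK N1 2)]

/-- Scale the weights of a term list (generic dimension). [folklore] -/
def scaleTermsN {n : ℕ} (a : ℚ) (ts : List (Term n)) : List (Term n) := ts.map fun t => (a * t.1, t.2)

/-- `evalQ (scaleTermsN a ts) = a · evalQ ts`. [folklore] -/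
theorem evalQ_scaleTermsN {n : ℕ} (a : ℚ) (ts : List (Term n)) (u : Fin n → ℚ) :
    evalQ (scaleTermsN a ts) u = a * evalQ ts u := by
  induction ts with
  | nil => simp [scaleTermsN]
  | cons t ts ih => simp only [scaleTermsN, List.map_cons, evalQ_cons] at ih ⊢; rw [ih]; ring

/-- The certificate's term list `S + T − λ·K − R − m‖u‖² + Π` with κ-scaling `lam`. [folklore] -/
def certTermsG (p : SiteG NK N1) (lam m : ℚ) (tcls : List (Bool × Off × Bool × Bool × List ℤ)) :
    List (Term (dimG NK N1)) :=
  let ths := thetaListG NK N1 p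
  supplyTermsG NK N1 p ths ++ transferTermsG NK N1 p tcls ++ negTermsN (scaleTermsN lam (kappaTermsG NK N1 p ths)) ++
    negTermsN (readoutTermsG NK N1 p ths betaTable) ++ scaleTermsN (-m) (normTermsG NK N1) ++ projTermsG NK N1

end Shape


/-! ### A cheaper certificate check: symmetry of the residual is automatic for a symmetrised matrix -/

/-- The residual of a rounded Gram certificate of a SYMMETRISED matrix is symmetric (no computation needed). [folklore] -/
theorem gramResidual_symm_comm {N m : ℕ} (M : Matrix (Fin N) (Fin N) ℚ) (d : Fin m → ℚ) (B : Matrix (Fin m) (Fin N) ℚ)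
    (i j : Fin N) : PSD.gramResidual (symm M) d B i j = PSD.gramResidual (symm M) d B j i := by
  simp only [PSD.gramResidual, symm]
  have h : ∑ k, d k * (B k i * B k j) = ∑ k, d k * (B k j * B k i) := Finset.sum_congr rfl fun k _ => by ring
  rw [h]; ring

/-- `PSD.IsGramCertDD` for a symmetrised matrix from the two COMPUTED conjuncts only (`d ≥ 0` and the row inequalities of the
residual); the symmetry conjunct is `gramResidual_symm_comm`.  Cuts the evaluated work of the trusted check to one third. [folklore] -/
theorem isGramCertDD_symm_of_rows {N m : ℕ} {M : Matrix (Fin N) (Fin N) ℚ} {d : Fin m → ℚ} {B : Matrix (Fin m) (Fin N) ℚ}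
    (hd : ∀ k, 0 ≤ d k)
    (hrows : ∀ i, ∑ j ∈ Finset.univ.erase i, |PSD.gramResidual (symm M) d B i j| ≤ PSD.gramResidual (symm M) d B i i) :
    PSD.IsGramCertDD (symm M) d B :=
  PSD.IsGramCertDD.intro hd (PSD.IsDiagDominant.intro (gramResidual_symm_comm M d B) hrows)

end Summit.AtomisticToContinuum.Crystallization.Theorems.StrictSplittingRuleTorusLMI
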